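import Summits.CriticalPhenomena.PercolationContinuityZ3.Theorems.PercNearOneGluingNoHeavyLowerTailKNGoodHairTools
import Summits.CriticalPhenomena.PercolationContinuityZ3.Theorems.PercNearOneGluingNoHeavyLowerTailKNGoodLoser
import Literature.Probability.Percolation.KozmaNitzanSeparatingTriple
import Literature.Probability.Percolation.KozmaNitzanGoodQuadruple
import HarnessLib

/-!
# `NoHeavyLowerTail` (stmt-CriticalPhenomena-4575) — the BLACK-BOX formal corner of the two-children kernel: statement and
# its easy cases (the partner not lonelier, or the glued port pair lighter)

Support file (`prim-nh-dp-blobmono` gen 9; `--supports stmt-CriticalPhenomena-4575`).  No definitions, no named facts, no sorries.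
Memo: `run/shared/lean/prim/prim-nh-dp-blobmono/gen9-g9/BLACKBOX-KERNEL.md` (+ `-ADDENDUM.md`).

Setting (`Fin n`, weights `w` = the core `K`, which may contain Steiner vertices; `μ_g = prodBernoulli g`).  An observer with
two Steiner children `x`, `s`: `x` a two-port one-layer vertex with relay ports `q₁, q₂` and `u = h₁h₂`, and `s` an ARBITRARY vertex
of `K` (the "black box": any structure behind it).  The torus reduction in `x` (lead LEAD-GEN9 §2e, lf-3 `twoPortSide_reduction`)
leaves one corner, the formal law `E0` (`x` joins both ports with probability `u`, nothing otherwise), whose value is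
  `V := (1−u)·[μ_K(s↔b) + D_K(s) − μ_K(j↔b)] + u·[μ_{K/(q₁q₂s)}([q₁q₂s]↔b) − μ_{K/(q₁q₂s)}(j↔b)]`,
`D_K(s) = Σ_{W∩A=∅} μ_K(C(s)=W)·min_{a∈A} μ_{K∖W}(a↔b)` Kozma–Nitzan's pocket term, `K/S` = weight `1` on the gluing pairs
(`Function.update`), `j` the relay minimising the SPLIT reliability `(1−u)μ_K(·↔b) + u μ_{K/q₁q₂}(·↔b)` (here only the rows that are
used are assumed).  Conjecture (BB2) of the memo: `V ≥ 0` always; with the two Lemma-5 corners it gives Kozma–Nitzan goodness of the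
observer for the class {two-port relay star, arbitrary vertex}.  This file proves the two EASY cases from KN's Lemma 4 in the gluing
form (9) (`KozmaNitzan2024_lemma4_glued`, tree) and the in-graph gluing transfer (`KNGoodHair.glueTransfer_openConn`, prim-hp-2):
* `corner_of_min` — master inequality: `V ≥ 0` as soon as
  `(1−u)(μ_K(sb) + D_K(s)) + u·min(μ_Γ(q₁b), μ_Γ(sb)) ≥ (1−u)μ_K(jb) + u μ_Γ(jb)` (`Γ := K/q₁q₂`), by Lemma 4 (9) at `(q₁, s; j)` in `Γ`.
* `corner_of_lighterPair` — the glued pair is `Γ`-lighter than `s` (`μ_Γ(q₁b) ≤ μ_Γ(sb)`): `V ≥ 0` from `KNGood K A s b`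
  (induction hypothesis on the black box), the split row of a `K`-minimiser `r ∈ A`, and `r ≤ [q₁q₂]` in `Γ` (gluing transfer).
* `corner_of_notLonely` — `s` is `Γ`-lighter than the pair but NOT lonelier than `j` in the split world: `V ≥ 0` (the pocket term is
  nonnegative).
The residual of (BB2) is therefore exactly: `s` `Γ`-lighter than `[q₁q₂]` AND lonelier than `j` in the split world (memo §4, ADDENDUM §A1/§A5).
* `corner_of_stableArgmin` (gen 10) — the HYPERGRAPH view: `V` is the goodness functional of `s` in `K + ({s,q₁,q₂} : u)`
  at the split-world witness `j`; if `j` also minimises the hypergraph reliabilities `(1−u)μ_K(·b) + uμ_{K/(q₁q₂s)}(·b)`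
  then `V ≥ 0` (goodness of `s` in `K` + two gluing transfers).  Residual after gen 10: additionally some relay is strictly
  below `j` in the hypergraph split (memo `gen10/BB2-SWEEP.md`).
-/

noncomputable section

namespace Summit.CriticalPhenomena.PercolationContinuityZ3.Theorems

open MeasureTheory Set Literature.Probability.LatticeModels Literature.Probability.Percolation
open scoped Classical BigOperators
open KNGoodAux

variable {n : ℕ}

namespace BlackBoxCorner

/-- Kozma–Nitzan's pocket term of the vertex `s` in the graph `g`:
`D_g(s) = Σ_{W ∩ A = ∅} μ_g(C(s) = W) · min_{a ∈ A} μ_g(a ↔ b off W)` (the correction term of `KNGood`). -/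
theorem pocket_nonneg (g : Sym2 (Fin n) → unitInterval) (A : Finset (Fin n)) (hA : A.Nonempty) (s b : Fin n) :
    0 ≤ ∑ W ∈ nullSets A, (prodBernoulli g).real (clusterIs s W) *
        A.inf' hA (fun a => (prodBernoulli g).real (openConnIn ((↑W : Set (Fin n))ᶜ) a b)) := by
  refine Finset.sum_nonneg fun W _ => mul_nonneg measureReal_nonneg ?_
  exact (Finset.le_inf'_iff hA _).2 fun a _ => measureReal_nonneg

/-- **Master inequality for the black-box formal corner.**  With `Γ := K[s(q₁,q₂) ↦ 1]` and `Γ' := Γ[s(q₁,s) ↦ 1]`: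
if `(1−u)·(μ_K(s↔b) + D_K(s)) + u·min(μ_Γ(q₁↔b), μ_Γ(s↔b)) ≥ (1−u)·μ_K(j↔b) + u·μ_Γ(j↔b)` then
`(1−u)·(μ_K(s↔b) + D_K(s) − μ_K(j↔b)) + u·(μ_{Γ'}(q₁↔b) − μ_{Γ'}(j↔b)) ≥ 0`.
Proof: Kozma–Nitzan Lemma 4 in the gluing form (9) for `(q₁, s; j)` in `Γ`.
[cite: KozmaNitzan2024, Lemma 4, eq. (9) (pp. 9–10)] -/
theorem corner_of_min (w : Sym2 (Fin n) → unitInterval) (A : Finset (Fin n)) (hA : A.Nonempty)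
    (b s q₁ q₂ j : Fin n) {u : ℝ} (hu0 : 0 ≤ u)
    (hmin : (1 - u) * (prodBernoulli w).real (openConn j b) +
        u * (prodBernoulli (Function.update w s(q₁, q₂) 1)).real (openConn j b) ≤
      (1 - u) * ((prodBernoulli w).real (openConn s b) +
          ∑ W ∈ nullSets A, (prodBernoulli w).real (clusterIs s W) *
            A.inf' hA (fun a => (prodBernoulli w).real (openConnIn ((↑W : Set (Fin n))ᶜ) a b))) +
        u * min ((prodBernoulli (Function.update w s(q₁, q₂) 1)).real (openConn q₁ b))
          ((prodBernoulli (Function.update w s(q₁, q₂) 1)).real (openConn s b))) :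
    0 ≤ (1 - u) * ((prodBernoulli w).real (openConn s b) +
          ∑ W ∈ nullSets A, (prodBernoulli w).real (clusterIs s W) *
            A.inf' hA (fun a => (prodBernoulli w).real (openConnIn ((↑W : Set (Fin n))ᶜ) a b)) -
          (prodBernoulli w).real (openConn j b)) +
      u * ((prodBernoulli (Function.update (Function.update w s(q₁, q₂) 1) s(q₁, s) 1)).real (openConn q₁ b) -
        (prodBernoulli (Function.update (Function.update w s(q₁, q₂) 1) s(q₁, s) 1)).real (openConn j b)) := by
  set Γ : Sym2 (Fin n) → unitInterval := Function.update w s(q₁, q₂) 1 with hΓ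
  -- Lemma 4 (9) in `Γ` for the pair `(q₁, s)` and the third party `j`
  have h9 := KozmaNitzan2024_lemma4_glued Γ q₁ s j b
  rw [min_sub_sub_right] at h9
  have key : u * (min ((prodBernoulli Γ).real (openConn q₁ b)) ((prodBernoulli Γ).real (openConn s b)) -
        (prodBernoulli Γ).real (openConn j b)) ≤
      u * ((prodBernoulli (Function.update Γ s(q₁, s) 1)).real (openConn q₁ b) -
        (prodBernoulli (Function.update Γ s(q₁, s) 1)).real (openConn j b)) :=
    mul_le_mul_of_nonneg_left h9 hu0
  nlinarith [key, hmin]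

/-- **Easy case 1: the glued pair is lighter than the black box.**  `q₁ ≠ q₂`, `q₂ ∈ A`; `KNGood K A s b` (the induction hypothesis on
`s`); the split row of `j` against every relay, `(1−u)μ_K(jb) + uμ_Γ(jb) ≤ (1−u)μ_K(ab) + uμ_Γ(ab)`; and `μ_Γ(q₁↔b) ≤ μ_Γ(s↔b)`.
Then the corner value is `≥ 0`.  Proof: a `K`-minimiser `r ∈ A` has `μ_K(rb) ≤ μ_K(sb) + D_K(s)` (goodness) and `μ_Γ(rb) ≤ μ_Γ(q₁b)`
(gluing transfer from `μ_K(rb) ≤ μ_K(q₂b)`); the row of `r` and `corner_of_min` finish.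
[cite: KozmaNitzan2024, Lemma 4 eq. (9), Lemma 5, §3.2 Definition of good (pp. 9–13)] -/
theorem corner_of_lighterPair (w : Sym2 (Fin n) → unitInterval) (A : Finset (Fin n)) (hA : A.Nonempty)
    (b s q₁ q₂ j : Fin n) (hq : q₁ ≠ q₂) (hq₂ : q₂ ∈ A) {u : ℝ} (hu0 : 0 ≤ u) (hu1 : u ≤ 1)
    (hgood : KNGood w A hA s b)
    (hrow : ∀ a ∈ A, (1 - u) * (prodBernoulli w).real (openConn j b) +
        u * (prodBernoulli (Function.update w s(q₁, q₂) 1)).real (openConn j b) ≤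
      (1 - u) * (prodBernoulli w).real (openConn a b) +
        u * (prodBernoulli (Function.update w s(q₁, q₂) 1)).real (openConn a b))
    (hpair : (prodBernoulli (Function.update w s(q₁, q₂) 1)).real (openConn q₁ b) ≤
      (prodBernoulli (Function.update w s(q₁, q₂) 1)).real (openConn s b)) :
    0 ≤ (1 - u) * ((prodBernoulli w).real (openConn s b) +
          ∑ W ∈ nullSets A, (prodBernoulli w).real (clusterIs s W) *
            A.inf' hA (fun a => (prodBernoulli w).real (openConnIn ((↑W : Set (Fin n))ᶜ) a b)) -
          (prodBernoulli w).real (openConn j b)) +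
      u * ((prodBernoulli (Function.update (Function.update w s(q₁, q₂) 1) s(q₁, s) 1)).real (openConn q₁ b) -
        (prodBernoulli (Function.update (Function.update w s(q₁, q₂) 1) s(q₁, s) 1)).real (openConn j b)) := by
  set μ := prodBernoulli w with hμ
  set Γ : Sym2 (Fin n) → unitInterval := Function.update w s(q₁, q₂) 1 with hΓ
  -- a `K`-minimiser `r ∈ A`
  obtain ⟨r, hr, hrmin⟩ := A.exists_min_image (fun a => μ.real (openConn a b)) hA
  -- goodness of `s` in `K`: `min_A μ_K(·b) − D_K(s) ≤ μ_K(sb)`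
  have hg : μ.real (openConn r b) ≤ μ.real (openConn s b) +
      ∑ W ∈ nullSets A, μ.real (clusterIs s W) *
        A.inf' hA (fun a => μ.real (openConnIn ((↑W : Set (Fin n))ᶜ) a b)) := by
    have h1 : A.inf' hA (fun a => μ.real (openConn a b)) ≤ μ.real (openConn r b) := Finset.inf'_le _ hr
    have h2 : μ.real (openConn r b) ≤ A.inf' hA (fun a => μ.real (openConn a b)) :=
      (Finset.le_inf'_iff hA _).2 fun a ha => hrmin a ha
    have h3 := hgood
    unfold KNGood at h3
    linarith
  -- gluing transfer: `μ_K(rb) ≤ μ_K(q₂b)` ⟹ `μ_Γ(rb) ≤ μ_Γ(q₁b)`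
  have ht : (prodBernoulli Γ).real (openConn r b) ≤ (prodBernoulli Γ).real (openConn q₁ b) :=
    KNGoodHair.glueTransfer_openConn w q₁ q₂ r b hq (hrmin q₂ hq₂)
  have hrowr := hrow r hr
  refine corner_of_min w A hA b s q₁ q₂ j hu0 ?_
  rw [min_eq_left hpair]
  have h1u : 0 ≤ 1 - u := by linarith
  nlinarith [mul_le_mul_of_nonneg_left hg h1u, mul_le_mul_of_nonneg_left ht hu0, hrowr]

/-- **Easy case 2: the black box is lighter than the pair but not lonelier than the witness.**  If `μ_Γ(s↔b) ≤ μ_Γ(q₁↔b)` and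
`(1−u)μ_K(jb) + uμ_Γ(jb) ≤ (1−u)μ_K(sb) + uμ_Γ(sb)` (`s` is at least as connected as `j` in the split world), the corner value is
`≥ 0` (the pocket term is nonnegative; `corner_of_min`).  Together with `corner_of_lighterPair` the open residual is:
`s` lighter than the pair AND lonelier than `j`.
[cite: KozmaNitzan2024, Lemma 4 eq. (9) (pp. 9–10)] -/
theorem corner_of_notLonely (w : Sym2 (Fin n) → unitInterval) (A : Finset (Fin n)) (hA : A.Nonempty)
    (b s q₁ q₂ j : Fin n) {u : ℝ} (hu0 : 0 ≤ u) (hu1 : u ≤ 1)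
    (hs : (1 - u) * (prodBernoulli w).real (openConn j b) +
        u * (prodBernoulli (Function.update w s(q₁, q₂) 1)).real (openConn j b) ≤
      (1 - u) * (prodBernoulli w).real (openConn s b) +
        u * (prodBernoulli (Function.update w s(q₁, q₂) 1)).real (openConn s b))
    (hlight : (prodBernoulli (Function.update w s(q₁, q₂) 1)).real (openConn s b) ≤
      (prodBernoulli (Function.update w s(q₁, q₂) 1)).real (openConn q₁ b)) :
    0 ≤ (1 - u) * ((prodBernoulli w).real (openConn s b) +
          ∑ W ∈ nullSets A, (prodBernoulli w).real (clusterIs s W) *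
            A.inf' hA (fun a => (prodBernoulli w).real (openConnIn ((↑W : Set (Fin n))ᶜ) a b)) -
          (prodBernoulli w).real (openConn j b)) +
      u * ((prodBernoulli (Function.update (Function.update w s(q₁, q₂) 1) s(q₁, s) 1)).real (openConn q₁ b) -
        (prodBernoulli (Function.update (Function.update w s(q₁, q₂) 1) s(q₁, s) 1)).real (openConn j b)) := by
  have hD := pocket_nonneg w A hA s b
  refine corner_of_min w A hA b s q₁ q₂ j hu0 ?_
  rw [min_eq_right hlight]
  have h1u : 0 ≤ 1 - u := by linarith
  nlinarith [mul_nonneg h1u hD, hs]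

/-- **Easy case 3: the witness stays loneliest once the black box joins the glued pair (hyperedge-stable argmin).**
The corner value `V` is the Kozma–Nitzan goodness functional of `s` in the "hypergraph" `K + ({s,q₁,q₂} : u)` (with
probability `u` the three vertices are glued, otherwise nothing), evaluated at the witness `j` of the SPLIT world
`K + (q₁q₂ : u)`.  If `j` is also a minimiser over `A` of the hypergraph reliabilities
`(1−u)·μ_K(·↔b) + u·μ_{Γ'}(·↔b)` (`Γ' := K[s(q₁,q₂) ↦ 1][s(q₁,s) ↦ 1]`), i.e. gluing `s` into `[q₁q₂]` in the `u`-world does not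
make another relay lonelier than `j`, then `V ≥ 0`: a `K`-minimiser `r ∈ A` has `μ_K(r b) ≤ μ_K(s b) + D_K(s)` (`KNGood K A s b`, the
induction hypothesis on the black box) and `μ_{Γ'}(r b) ≤ μ_{Γ'}(q₁ b)` (two gluing transfers: `r ≤_K q₂`, then `r ≤_Γ q₁`), and the
hypergraph row of `j` against `r` finishes.  Together with `corner_of_lighterPair` / `corner_of_notLonely` the residual of (BB2) is:
`s` `Γ`-lighter than the pair, lonelier than `j` in the split world, AND some relay strictly below `j` in the hypergraph split
(memo `prim-nh-dp-blobmono/gen10/BB2-SWEEP.md`; exact census: this case removes 686 of the 717 previously residual grid instances).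
[cite: KozmaNitzan2024, Lemma 5, §3.2 Definition of good (pp. 12–13)] -/
theorem corner_of_stableArgmin (w : Sym2 (Fin n) → unitInterval) (A : Finset (Fin n)) (hA : A.Nonempty)
    (b s q₁ q₂ j : Fin n) (hq : q₁ ≠ q₂) (hq₁s : q₁ ≠ s) (hq₂ : q₂ ∈ A) {u : ℝ} (hu0 : 0 ≤ u) (hu1 : u ≤ 1)
    (hgood : KNGood w A hA s b)
    (hrow : ∀ a ∈ A, (1 - u) * (prodBernoulli w).real (openConn j b) +
        u * (prodBernoulli (Function.update (Function.update w s(q₁, q₂) 1) s(q₁, s) 1)).real (openConn j b) ≤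
      (1 - u) * (prodBernoulli w).real (openConn a b) +
        u * (prodBernoulli (Function.update (Function.update w s(q₁, q₂) 1) s(q₁, s) 1)).real (openConn a b)) :
    0 ≤ (1 - u) * ((prodBernoulli w).real (openConn s b) +
          ∑ W ∈ nullSets A, (prodBernoulli w).real (clusterIs s W) *
            A.inf' hA (fun a => (prodBernoulli w).real (openConnIn ((↑W : Set (Fin n))ᶜ) a b)) -
          (prodBernoulli w).real (openConn j b)) +
      u * ((prodBernoulli (Function.update (Function.update w s(q₁, q₂) 1) s(q₁, s) 1)).real (openConn q₁ b) -
        (prodBernoulli (Function.update (Function.update w s(q₁, q₂) 1) s(q₁, s) 1)).real (openConn j b)) := by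
  set μ := prodBernoulli w with hμ
  set Γ : Sym2 (Fin n) → unitInterval := Function.update w s(q₁, q₂) 1 with hΓ
  -- a `K`-minimiser `r ∈ A`
  obtain ⟨r, hr, hrmin⟩ := A.exists_min_image (fun a => μ.real (openConn a b)) hA
  -- goodness of `s` in `K`: `min_A μ_K(·b) − D_K(s) ≤ μ_K(sb)`
  have hg : μ.real (openConn r b) ≤ μ.real (openConn s b) +
      ∑ W ∈ nullSets A, μ.real (clusterIs s W) *
        A.inf' hA (fun a => μ.real (openConnIn ((↑W : Set (Fin n))ᶜ) a b)) := by
    have h1 : A.inf' hA (fun a => μ.real (openConn a b)) ≤ μ.real (openConn r b) := Finset.inf'_le _ hr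
    have h2 : μ.real (openConn r b) ≤ A.inf' hA (fun a => μ.real (openConn a b)) :=
      (Finset.le_inf'_iff hA _).2 fun a ha => hrmin a ha
    have h3 := hgood
    unfold KNGood at h3
    linarith
  -- first gluing transfer: `μ_K(rb) ≤ μ_K(q₂b)` ⟹ `μ_Γ(rb) ≤ μ_Γ(q₁b)`
  have ht1 : (prodBernoulli Γ).real (openConn r b) ≤ (prodBernoulli Γ).real (openConn q₁ b) :=
    KNGoodHair.glueTransfer_openConn w q₁ q₂ r b hq (hrmin q₂ hq₂)
  -- second gluing transfer, pair `s(s, q₁)` in `Γ`: `μ_Γ(rb) ≤ μ_Γ(q₁b)` ⟹ `μ_{Γ'}(rb) ≤ μ_{Γ'}(sb) = μ_{Γ'}(q₁b)`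
  have ht2' : (prodBernoulli (Function.update Γ s(s, q₁) 1)).real (openConn r b) ≤
      (prodBernoulli (Function.update Γ s(s, q₁) 1)).real (openConn s b) :=
    KNGoodHair.glueTransfer_openConn Γ s q₁ r b hq₁s.symm ht1
  have hswap : (s(s, q₁) : Sym2 (Fin n)) = s(q₁, s) := Sym2.eq_swap
  rw [hswap] at ht2'
  have hglued : (prodBernoulli (Function.update Γ s(q₁, s) 1)).real (openConn s b) =
      (prodBernoulli (Function.update Γ s(q₁, s) 1)).real (openConn q₁ b) :=
    KNGoodLoser.real_openConn_update_one_glued Γ q₁ s b hq₁s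
  rw [hglued] at ht2'
  -- the hypergraph row of `j` against `r`, and bookkeeping
  have hrowr := hrow r hr
  have h1u : 0 ≤ 1 - u := by linarith
  nlinarith [mul_le_mul_of_nonneg_left hg h1u, mul_le_mul_of_nonneg_left ht2' hu0, hrowr]

end BlackBoxCorner

end Summit.CriticalPhenomena.PercolationContinuityZ3.Theorems

end
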